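import Summits.AtomisticToContinuum.BoseEinsteinCondensation.Theses.BECCellInformation
import Summits.AtomisticToContinuum.BoseEinsteinCondensation.Theorems.BECCutLineWeakDisorderFlatModeFromLandscape
import Literature.MathematicalPhysics.QuantumManyBody.SwapPurity
import Literature.MathematicalPhysics.QuantumManyBody.DyadicCoherentFractionLimit
import Literature.MathematicalPhysics.QuantumManyBody.DyadicCoherentFractionRefinement
import Mathlib
import HarnessLib

/-!
# Route `BECCellInformation` — support item `EntropicZeroMode` (stmt-AtomisticToContinuum-13444)

`CondEntropyBound → zero-mode occupation ≥ c N` for NON-NEGATIVE near-minimisers, proved as stated.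

Mathematics (Rényi-½ / Jensen, done with tangent lines so that only `1 - w ≤ e^{-w}` is used).
Fix `n`, `L > 0`, `V = L³`, a nonnegative `Ψ ∈ TrialState (n+1) L`; write `f_Y(x) = |Ψ(x, Y)|`,
`m(Y) = ∫ f_Y²`, `s(Y) = ∫ f_Y`, and `k(Y) = ∫_Λ (m/V)·klFun(V f_Y²/m) dx = m(Y)·KL(p(·|Y) ‖ u_Λ)`.

* inner step (per `Y`): with `t = V f²/m` and `a = -KL/2`, the pointwise inequality
  `e^a ((1+t)/2 - a t - klFun t / 2) ≤ √t` (which is `e^w (1 - w) ≤ 1` at `w = a + log √t`)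
  integrates over `Λ` to `V e^{-KL/2} ≤ √(V/m) s`, i.e. `m e^{-k/m} ≤ s²/V`;
* outer step: `e^{-b}(m + b m - k) ≤ m e^{-k/m}` pointwise (`1 + x ≤ eˣ`), integrated in `Y` with
  `∫ m = 1`, `b = ∫ k ≤ max C 0`, gives `e^{-max C 0} ≤ ∫ m e^{-k/m} dY ≤ ∫ s²/V dY`;
* `occupation (n+1) φ₀ Ψ = (n+1) ∫ s(Y)²/V dY` for `Ψ ≥ 0` (`enorm_integral_conj_flatMode_mul_slice`).

So `c = exp (-max C 0)` works (chosen before `N`; immune to the sign of `C`), and the filter is shifted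
`N = n + 1`. No named facts are used (unconditional).
-/

noncomputable section

open MeasureTheory Set Filter InformationTheory
open scoped ENNReal NNReal ComplexConjugate

namespace Summit.AtomisticToContinuum.BoseEinsteinCondensation.Theorems

open Literature.MathematicalPhysics.QuantumManyBody.BoseGas

namespace EntropicZeroMode

/-! ### Pointwise tangent-line inequalities -/

/-- `e^w (1 - w) ≤ 1` (the tangent line of `e^{-w}` at `0`). [folklore] -/
theorem exp_mul_one_sub_le (w : ℝ) : Real.exp w * (1 - w) ≤ 1 := by
  have h := Real.add_one_le_exp (-w)
  calc Real.exp w * (1 - w) ≤ Real.exp w * Real.exp (-w) :=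
        mul_le_mul_of_nonneg_left (by linarith) (Real.exp_pos w).le
    _ = 1 := by rw [← Real.exp_add, add_neg_cancel, Real.exp_zero]

/-- Inner pointwise inequality: for `t ≥ 0` and any `a`,
`e^a ((1 + t)/2 - a t - klFun t / 2) ≤ √t` (at `t > 0` this is `e^w (1 - w) ≤ 1` with
`w = a + log √t`, multiplied by `√t · √t = t`). [folklore] -/
theorem exp_mul_klFun_comb_le_sqrt {t : ℝ} (ht : 0 ≤ t) (a : ℝ) :
    Real.exp a * ((1 + t) / 2 - a * t - klFun t / 2) ≤ Real.sqrt t := by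
  rcases ht.eq_or_lt with rfl | htpos
  · simp [klFun_zero]
  set s := Real.sqrt t with hs
  have hspos : 0 < s := Real.sqrt_pos.2 htpos
  have hts : t = s ^ 2 := (Real.sq_sqrt ht).symm
  have hlog : Real.log t = 2 * Real.log s := by
    rw [hts, Real.log_pow]; norm_num
  have hrew : (1 + t) / 2 - a * t - klFun t / 2 = s * (s * (1 - (a + Real.log s))) := by
    rw [klFun_apply, hlog, hts]; ring
  rw [hrew]
  have hexp : Real.exp a * s = Real.exp (a + Real.log s) := by
    rw [Real.exp_add, Real.exp_log hspos]
  calc Real.exp a * (s * (s * (1 - (a + Real.log s))))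
      = s * (Real.exp (a + Real.log s) * (1 - (a + Real.log s))) := by rw [← hexp]; ring
    _ ≤ s * 1 := mul_le_mul_of_nonneg_left (exp_mul_one_sub_le _) hspos.le
    _ = s := mul_one s

/-- Outer pointwise inequality: for `M ≥ 0`, `k ≥ 0` and any `b`,
`e^{-b} (M + b M - k) ≤ M e^{-k/M}` (`1 + x ≤ eˣ` at `x = b - k/M`; for `M = 0` the left side is
`-e^{-b} k ≤ 0`). [folklore] -/
theorem exp_neg_mul_le_mul_exp_neg_div {M k : ℝ} (hM : 0 ≤ M) (hk : 0 ≤ k) (b : ℝ) :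
    Real.exp (-b) * (M + b * M - k) ≤ M * Real.exp (-(k / M)) := by
  rcases hM.eq_or_lt with rfl | hMpos
  · have : Real.exp (-b) * k ≥ 0 := mul_nonneg (Real.exp_pos _).le hk
    simp only [zero_add, mul_zero, zero_sub, mul_neg, zero_mul, neg_nonpos]
    exact this
  have h := Real.add_one_le_exp (b - k / M)
  have h2 : Real.exp (-b) * (M * (b - k / M + 1)) ≤ Real.exp (-b) * (M * Real.exp (b - k / M)) :=
    mul_le_mul_of_nonneg_left (mul_le_mul_of_nonneg_left h hMpos.le) (Real.exp_pos _).le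
  calc Real.exp (-b) * (M + b * M - k) = Real.exp (-b) * (M * (b - k / M + 1)) := by
        field_simp
        ring
    _ ≤ Real.exp (-b) * (M * Real.exp (b - k / M)) := h2
    _ = M * Real.exp (-(k / M)) := by
        rw [sub_eq_add_neg, Real.exp_add]
        calc Real.exp (-b) * (M * (Real.exp b * Real.exp (-(k / M))))
            = M * (Real.exp (-b) * Real.exp b) * Real.exp (-(k / M)) := by ring
          _ = M * Real.exp (-(k / M)) := by rw [← Real.exp_add, neg_add_cancel, Real.exp_zero, mul_one]

/-! ### The inner step: one slice `x ↦ |Ψ(x, Y)|` -/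

/-- `volume.real Λ_L = L³` for `L ≥ 0`. [folklore] -/
theorem volume_real_box {L : ℝ} (hL : 0 ≤ L) : volume.real (box L) = L ^ 3 := by
  rw [measureReal_def, _root_.AtomisticToContinuum.BECInfraredBound.volume_box, ENNReal.toReal_pow,
    ENNReal.toReal_ofReal hL]

/-- **Inner step (Rényi-½ divergence ≤ KL, integrated with tangent lines).** For `L > 0` and a
continuous `f ≥ 0` on `ℝ³` vanishing off `Λ_L`, integrable with integrable square, `m = ∫ f²` and
`k = ∫_Λ (m/L³)·klFun(L³ f²/m) < ∞` (this is `m · KL(f²/m ‖ u_Λ)`), one has `m · e^{-k/m} ≤ (∫ f)²/L³`.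
[folklore] -/
theorem sliceMass_mul_exp_neg_le {L : ℝ} (hL : 0 < L) {f : Space → ℝ} (hfc : Continuous f)
    (hf0 : ∀ x, 0 ≤ f x) (hfΛ : ∀ x, x ∉ box L → f x = 0) (hfi : Integrable f)
    (hf2 : Integrable fun x => f x ^ 2)
    (hk : ∫⁻ x in box L, ENNReal.ofReal ((∫ z, f z ^ 2) / L ^ 3 *
      klFun (L ^ 3 * f x ^ 2 / ∫ z, f z ^ 2)) ≠ ⊤) :
    (∫ z, f z ^ 2) * Real.exp (-((∫⁻ x in box L, ENNReal.ofReal ((∫ z, f z ^ 2) / L ^ 3 *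
      klFun (L ^ 3 * f x ^ 2 / ∫ z, f z ^ 2))).toReal / ∫ z, f z ^ 2)) ≤ (∫ x, f x) ^ 2 / L ^ 3 := by
  set V := L ^ 3 with hV
  set M := ∫ z, f z ^ 2 with hM
  have hVpos : 0 < V := by positivity
  have hM0 : 0 ≤ M := integral_nonneg fun z => by positivity
  rcases hM0.eq_or_lt with hM00 | hMpos
  · rw [← hM00, zero_mul]; positivity
  -- the `klFun` integrand `g = (M/V) klFun(V f²/M) ≥ 0`, integrable on `Λ` with integral `k`
  set g : Space → ℝ := fun x => M / V * klFun (V * f x ^ 2 / M) with hg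
  have hg0 : ∀ x, 0 ≤ g x := fun x =>
    mul_nonneg (div_nonneg hM0 hVpos.le) (klFun_nonneg (by positivity))
  have hgm : Measurable g := by
    have hfm : Measurable f := hfc.measurable
    simp only [hg]
    fun_prop
  have hgi : IntegrableOn g (box L) := by
    refine ⟨hgm.aestronglyMeasurable, ?_⟩
    rw [hasFiniteIntegral_iff_ofReal (ae_of_all _ hg0)]
    exact lt_top_iff_ne_top.2 hk
  set k := ∫ x in box L, g x with hkdef
  have hk_eq : (∫⁻ x in box L, ENNReal.ofReal (M / V * klFun (V * f x ^ 2 / M))).toReal = k := by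
    rw [hkdef, integral_eq_lintegral_of_nonneg_ae (ae_of_all _ hg0) hgm.aestronglyMeasurable]
  rw [hk_eq]
  -- useful integrals over `Λ`
  have hvol : volume (box L) ≠ ⊤ := by
    rw [_root_.AtomisticToContinuum.BECInfraredBound.volume_box]
    exact ENNReal.pow_ne_top ENNReal.ofReal_ne_top
  have hIf2 : ∫ x in box L, f x ^ 2 = M :=
    setIntegral_eq_integral_of_forall_compl_eq_zero fun x hx => by rw [hfΛ x hx]; ring
  have hIf : ∫ x in box L, f x = ∫ x, f x :=
    setIntegral_eq_integral_of_forall_compl_eq_zero hfΛ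
  set S := ∫ x, f x with hS
  have hS0 : 0 ≤ S := integral_nonneg hf0
  -- tangent point
  set a : ℝ := -(k / M) / 2 with ha
  -- pointwise inequality on the slice
  have hpt : ∀ x, Real.exp a / 2 + Real.exp a * (1 / 2 - a) * (V / M) * f x ^ 2 -
      Real.exp a * V / (2 * M) * g x ≤ Real.sqrt (V / M) * f x := by
    intro x
    have h := exp_mul_klFun_comb_le_sqrt (t := V * f x ^ 2 / M) (by positivity) a
    have hsq : Real.sqrt (V * f x ^ 2 / M) = Real.sqrt (V / M) * f x := by
      rw [show V * f x ^ 2 / M = V / M * f x ^ 2 by ring, Real.sqrt_mul (div_nonneg hVpos.le hM0),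
        Real.sqrt_sq (hf0 x)]
    rw [hsq] at h
    convert h using 1
    simp only [hg]
    field_simp
    ring
  -- integrate it over `Λ`
  have hIc : IntegrableOn (fun _ : Space => Real.exp a / 2) (box L) := integrableOn_const hvol
  have hIq : IntegrableOn (fun x => Real.exp a * (1 / 2 - a) * (V / M) * f x ^ 2) (box L) :=
    hf2.integrableOn.const_mul _
  have hIcq : IntegrableOn (fun x => Real.exp a / 2 + Real.exp a * (1 / 2 - a) * (V / M) * f x ^ 2)
      (box L) := hIc.add hIq
  have hIg : IntegrableOn (fun x => Real.exp a * V / (2 * M) * g x) (box L) := hgi.const_mul _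
  have hint : ∫ x in box L, (Real.exp a / 2 + Real.exp a * (1 / 2 - a) * (V / M) * f x ^ 2 -
      Real.exp a * V / (2 * M) * g x) ≤ ∫ x in box L, Real.sqrt (V / M) * f x :=
    integral_mono (hIcq.sub hIg) (hfi.integrableOn.const_mul _) hpt
  have hLHS : ∫ x in box L, (Real.exp a / 2 + Real.exp a * (1 / 2 - a) * (V / M) * f x ^ 2 -
      Real.exp a * V / (2 * M) * g x) = V * Real.exp a := by
    rw [integral_sub hIcq hIg, integral_add hIc hIq, setIntegral_const, integral_const_mul,
      integral_const_mul, hIf2, volume_real_box hL.le, smul_eq_mul]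
    rw [← hkdef, ha]
    field_simp
    ring
  have hRHS : ∫ x in box L, Real.sqrt (V / M) * f x = Real.sqrt (V / M) * S := by
    rw [integral_const_mul, hIf]
  rw [hLHS, hRHS] at hint
  -- square: `V² e^{2a} ≤ (V/M) S²`, i.e. `M e^{-k/M} ≤ S²/V`
  have h3 : V * V * Real.exp (-(k / M)) ≤ V / M * S ^ 2 := by
    have h2 := mul_self_le_mul_self (by positivity) hint
    calc V * V * Real.exp (-(k / M)) = V * Real.exp a * (V * Real.exp a) := by
          rw [show -(k / M) = a + a by rw [ha]; ring, Real.exp_add]; ring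
      _ ≤ Real.sqrt (V / M) * S * (Real.sqrt (V / M) * S) := h2
      _ = V / M * S ^ 2 := by
          rw [mul_mul_mul_comm, Real.mul_self_sqrt (by positivity)]; ring
  rw [le_div_iff₀ hVpos]
  have h4 := mul_le_mul_of_nonneg_left h3 (show 0 ≤ M / V by positivity)
  calc M * Real.exp (-(k / M)) * V = M / V * (V * V * Real.exp (-(k / M))) := by
        field_simp
    _ ≤ M / V * (V / M * S ^ 2) := h4
    _ = S ^ 2 := by field_simp

/-! ### The outer step: Jensen under the law `m(Y) dY` -/

/-- `Y ↦ M e^{-k/M}` is integrable when `M, k ≥ 0` are (it is dominated by `M`). [folklore] -/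
theorem integrable_mul_exp_neg_div {α : Type*} [MeasurableSpace α] {μ : Measure α}
    {M k : α → ℝ} (hM0 : ∀ y, 0 ≤ M y) (hk0 : ∀ y, 0 ≤ k y) (hMi : Integrable M μ)
    (hki : Integrable k μ) : Integrable (fun y => M y * Real.exp (-(k y / M y))) μ := by
  have hmeas : AEStronglyMeasurable (fun y => M y * Real.exp (-(k y / M y))) μ := by
    have h1 : AEMeasurable M μ := hMi.aemeasurable
    have h2 : AEMeasurable k μ := hki.aemeasurable
    exact (h1.mul (Real.measurable_exp.comp_aemeasurable ((h2.div h1).neg))).aestronglyMeasurable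
  refine hMi.mono' hmeas (ae_of_all _ fun y => ?_)
  rw [Real.norm_eq_abs, abs_of_nonneg (mul_nonneg (hM0 y) (Real.exp_pos _).le)]
  refine mul_le_of_le_one_right (hM0 y) (Real.exp_le_one_iff.2 ?_)
  exact neg_nonpos.2 (div_nonneg (hk0 y) (hM0 y))

/-- **Outer step (Jensen for `e^{-·}` under the probability law `M dμ`, with tangent lines).** If
`M, k ≥ 0` are integrable with `∫ M = 1` and `∫ k ≤ K₀`, then `e^{-K₀} ≤ ∫ M e^{-k/M}`. [folklore] -/
theorem exp_neg_le_integral_mul_exp_neg_div {α : Type*} [MeasurableSpace α] {μ : Measure α}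
    {M k : α → ℝ} (hM0 : ∀ y, 0 ≤ M y) (hk0 : ∀ y, 0 ≤ k y) (hMi : Integrable M μ)
    (hM1 : ∫ y, M y ∂μ = 1) (hki : Integrable k μ) {K₀ : ℝ} (hK : ∫ y, k y ∂μ ≤ K₀) :
    Real.exp (-K₀) ≤ ∫ y, M y * Real.exp (-(k y / M y)) ∂μ := by
  set b := ∫ y, k y ∂μ with hb
  have hInt := integrable_mul_exp_neg_div hM0 hk0 hMi hki
  have hpt : ∀ y, Real.exp (-b) * (M y + b * M y - k y) ≤ M y * Real.exp (-(k y / M y)) := fun y =>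
    exp_neg_mul_le_mul_exp_neg_div (hM0 y) (hk0 y) b
  have hI1 : Integrable (fun y => M y + b * M y) μ := hMi.add (hMi.const_mul b)
  have hI2 : Integrable (fun y => M y + b * M y - k y) μ := hI1.sub hki
  have hI3 : Integrable (fun y => Real.exp (-b) * (M y + b * M y - k y)) μ := hI2.const_mul _
  have hint := integral_mono hI3 hInt hpt
  have hLHS : ∫ y, Real.exp (-b) * (M y + b * M y - k y) ∂μ = Real.exp (-b) := by
    rw [integral_const_mul, integral_sub hI1 hki, integral_add hMi (hMi.const_mul b),
      integral_const_mul, hM1, ← hb]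
    ring
  rw [hLHS] at hint
  exact (Real.exp_le_exp.2 (neg_le_neg hK)).trans hint

/-! ### Slices of a nonnegative trial state and the key estimate -/

variable {n : ℕ} {L : ℝ}

/-- The slice `x ↦ Ψ(x, Y)` has compact support. [folklore] -/
theorem hasCompactSupport_slice (Ψ : TrialState (n + 1) L) (Y : Config n) :
    HasCompactSupport fun x : Space => Ψ.ψ (Matrix.vecCons x Y) :=
  Ψ.hasCompactSupport.comp_isClosedEmbedding
    (Isometry.isClosedEmbedding fun x y => by rw [edist_dist, edist_dist, dist_vecCons_vecCons])

/-- `x ↦ |Ψ(x, Y)|²` is integrable (continuous with compact support). [folklore] -/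
theorem integrable_norm_sq_slice (Ψ : TrialState (n + 1) L) (Y : Config n) :
    Integrable fun x : Space => ‖Ψ.ψ (Matrix.vecCons x Y)‖ ^ 2 := by
  have hc : Continuous fun x : Space => ‖Ψ.ψ (Matrix.vecCons x Y)‖ ^ 2 :=
    (FlatModeFromLandscape.continuous_slice Ψ Y).norm.pow 2
  have hg0 : (fun z : ℂ => ‖z‖ ^ 2) 0 = 0 := by simp
  have hs : HasCompactSupport ((fun z : ℂ => ‖z‖ ^ 2) ∘ fun x : Space => Ψ.ψ (Matrix.vecCons x Y)) :=
    (hasCompactSupport_slice Ψ Y).comp_left hg0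
  exact hc.integrable_of_hasCompactSupport hs

/-- `Y ↦ m(Y) = ∫ |Ψ(z, Y)|² dz` is measurable (Fubini). [folklore] -/
theorem measurable_sliceMassReal (Ψ : TrialState (n + 1) L) :
    Measurable fun Y : Config n => ∫ z, ‖Ψ.ψ (Matrix.vecCons z Y)‖ ^ 2 := by
  have hΨm : Measurable Ψ.ψ := Ψ.contDiff.continuous.measurable
  have h : StronglyMeasurable
      (Function.uncurry fun (Y : Config n) (z : Space) => ‖Ψ.ψ (Matrix.vecCons z Y)‖ ^ 2) :=
    ((hΨm.comp (measurable_vecCons_snd_fst n)).norm.pow_const 2).stronglyMeasurable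
  exact (h.integral_prod_right' (ν := (volume : Measure Space))).measurable

/-- **Key estimate.** For `L > 0` and a nonnegative `Ψ ∈ TrialState (n+1) L` whose mean conditional
relative entropy `∫ dY ∫_Λ (m/L³) klFun(L³|Ψ(x,Y)|²/m) dx` is `≤ C`, the flat mode
`φ₀ = L^{-3/2} 1_Λ` has occupation `≥ e^{-max C 0} (n+1)`. [folklore] -/
theorem occupation_flatMode_ge (hL : 0 < L) (Ψ : TrialState (n + 1) L)
    (hΨ : ∀ X, Ψ.ψ X = (‖Ψ.ψ X‖ : ℂ)) {C : ℝ}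
    (hC : ∫⁻ Y : Config n, ∫⁻ x in box L, ENNReal.ofReal ((∫ z, ‖Ψ.ψ (Matrix.vecCons z Y)‖ ^ 2) /
      L ^ 3 * klFun (L ^ 3 * ‖Ψ.ψ (Matrix.vecCons x Y)‖ ^ 2 / ∫ z, ‖Ψ.ψ (Matrix.vecCons z Y)‖ ^ 2)) ≤
      ENNReal.ofReal C) :
    ENNReal.ofReal (Real.exp (-max C 0) * ((n + 1 : ℕ) : ℝ)) ≤
      occupation (n + 1) ((box L).indicator fun _ => ((Real.sqrt (L ^ 3))⁻¹ : ℂ)) Ψ.ψ := by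
  set V := L ^ 3 with hV
  have hVpos : 0 < V := by positivity
  have hΨm : Measurable Ψ.ψ := Ψ.contDiff.continuous.measurable
  -- slice data: `M Y = ∫ |Ψ(·,Y)|²`, `S Y = ∫ |Ψ(·,Y)|`, `κ Y = M(Y)·KL(p(·|Y) ‖ u_Λ)` in `[0, ∞]`
  set M : Config n → ℝ := fun Y => ∫ z, ‖Ψ.ψ (Matrix.vecCons z Y)‖ ^ 2 with hMdef
  set S : Config n → ℝ := fun Y => ∫ x, ‖Ψ.ψ (Matrix.vecCons x Y)‖ with hSdef
  set κ : Config n → ℝ≥0∞ := fun Y => ∫⁻ x in box L,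
    ENNReal.ofReal (M Y / V * klFun (V * ‖Ψ.ψ (Matrix.vecCons x Y)‖ ^ 2 / M Y)) with hκdef
  have hC' : ∫⁻ Y, κ Y ≤ ENNReal.ofReal C := hC
  have hM0 : ∀ Y, 0 ≤ M Y := fun Y => integral_nonneg fun z => by positivity
  have hS0 : ∀ Y, 0 ≤ S Y := fun Y => integral_nonneg fun z => norm_nonneg _
  -- measurability of `M` and `κ`
  have hMm : Measurable M := measurable_sliceMassReal Ψ
  have hH : Measurable fun p : Config n × Space =>
      ENNReal.ofReal (M p.1 / V * klFun (V * ‖Ψ.ψ (Matrix.vecCons p.2 p.1)‖ ^ 2 / M p.1)) := by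
    have h1 : Measurable fun p : Config n × Space => M p.1 := hMm.comp measurable_fst
    have h2 : Measurable fun p : Config n × Space => ‖Ψ.ψ (Matrix.vecCons p.2 p.1)‖ :=
      (hΨm.comp (measurable_vecCons_snd_fst n)).norm
    exact ENNReal.measurable_ofReal.comp
      ((h1.div_const V).mul (measurable_klFun.comp (((h2.pow_const 2).const_mul V).div h1)))
  have hκm : Measurable κ := hH.lintegral_prod_right'
  -- `κ` is a.e. finite and `k = toReal ∘ κ` is integrable with `∫ k ≤ max C 0`
  have hκtop : ∫⁻ Y, κ Y ≠ ⊤ := ne_top_of_le_ne_top ENNReal.ofReal_ne_top hC'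
  have hκae : ∀ᵐ Y, κ Y < ⊤ := ae_lt_top hκm hκtop
  have hki : Integrable fun Y => (κ Y).toReal :=
    integrable_toReal_of_lintegral_ne_top hκm.aemeasurable hκtop
  have hk_int : ∫ Y, (κ Y).toReal ≤ max C 0 := by
    rw [integral_toReal hκm.aemeasurable hκae, ← ENNReal.toReal_ofReal' (r := C)]
    exact ENNReal.toReal_mono ENNReal.ofReal_ne_top hC'
  -- `M` is integrable with `∫ M = 1`
  have hMℓ : ∀ Y, ∫⁻ x, (‖Ψ.ψ (Matrix.vecCons x Y)‖₊ : ℝ≥0∞) ^ 2 = ENNReal.ofReal (M Y) := fun Y =>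
    lintegral_nnnorm_sq_eq_ofReal (integrable_norm_sq_slice Ψ Y)
  have hMℓm : Measurable fun Y : Config n => ∫⁻ x, (‖Ψ.ψ (Matrix.vecCons x Y)‖₊ : ℝ≥0∞) ^ 2 :=
    measurable_lintegral_sq_nnnorm_vecCons hΨm
  have hMℓ1 : ∫⁻ Y : Config n, ∫⁻ x, (‖Ψ.ψ (Matrix.vecCons x Y)‖₊ : ℝ≥0∞) ^ 2 = 1 := by
    rw [lintegral_lintegral_sq_nnnorm_vecCons hΨm]
    exact Ψ.norm_eq
  have hMtoReal : ∀ Y, (∫⁻ x, (‖Ψ.ψ (Matrix.vecCons x Y)‖₊ : ℝ≥0∞) ^ 2).toReal = M Y := fun Y => by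
    rw [hMℓ Y, ENNReal.toReal_ofReal (hM0 Y)]
  have hMi : Integrable M :=
    (integrable_toReal_of_lintegral_ne_top hMℓm.aemeasurable
      (by rw [hMℓ1]; exact ENNReal.one_ne_top)).congr (ae_of_all _ hMtoReal)
  have hM1 : ∫ Y, M Y = 1 := by
    have hcongr : ∫ Y, (∫⁻ x, (‖Ψ.ψ (Matrix.vecCons x Y)‖₊ : ℝ≥0∞) ^ 2).toReal = ∫ Y, M Y :=
      integral_congr_ae (ae_of_all _ hMtoReal)
    rw [← hcongr, integral_toReal hMℓm.aemeasurable
      (ae_of_all _ fun Y => by rw [hMℓ Y]; exact ENNReal.ofReal_lt_top), hMℓ1, ENNReal.toReal_one]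
  -- Step A: `occupation = (n+1) ∫ S²/V`
  have hocc : ∀ Y, (‖∫ x, conj ((box L).indicator (fun _ => ((Real.sqrt (L ^ 3))⁻¹ : ℂ)) x) *
      Ψ.ψ (Matrix.vecCons x Y)‖₊ : ℝ≥0∞) ^ 2 = ENNReal.ofReal (S Y ^ 2 / V) := by
    intro Y
    have hSℓ : ∫⁻ x, (‖Ψ.ψ (Matrix.vecCons x Y)‖₊ : ℝ≥0∞) = ENNReal.ofReal (S Y) := by
      rw [hSdef, ofReal_integral_norm_eq_lintegral_enorm (FlatModeFromLandscape.integrable_slice Ψ Y)]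
      rfl
    rw [FlatModeFromLandscape.enorm_integral_conj_flatMode_mul_slice hL Ψ hΨ Y, hSℓ, mul_pow,
      ← ENNReal.inv_pow, ← ENNReal.ofReal_pow (Real.sqrt_nonneg _), Real.sq_sqrt hVpos.le,
      ← ENNReal.ofReal_pow (hS0 Y), ENNReal.ofReal_div_of_pos hVpos, div_eq_mul_inv, mul_comm]
  rw [occupation_succ, lintegral_congr hocc]
  -- Step B: for a.e. `Y`, `M e^{-k/M} ≤ S²/V` (inner step on the slice)
  have hae : ∀ᵐ Y, ENNReal.ofReal (M Y * Real.exp (-((κ Y).toReal / M Y))) ≤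
      ENNReal.ofReal (S Y ^ 2 / V) := by
    filter_upwards [hκae] with Y hY
    refine ENNReal.ofReal_le_ofReal ?_
    exact sliceMass_mul_exp_neg_le hL (f := fun x => ‖Ψ.ψ (Matrix.vecCons x Y)‖)
      (FlatModeFromLandscape.continuous_slice Ψ Y).norm (fun x => norm_nonneg _)
      (fun x hx => by rw [FlatModeFromLandscape.slice_eq_zero Ψ Y hx, norm_zero])
      (FlatModeFromLandscape.integrable_slice Ψ Y).norm (integrable_norm_sq_slice Ψ Y) hY.ne
  -- Step C: Jensen in `Y` and the chain
  have hk0 : ∀ Y, 0 ≤ (κ Y).toReal := fun Y => ENNReal.toReal_nonneg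
  have hJ : Real.exp (-max C 0) ≤ ∫ Y, M Y * Real.exp (-((κ Y).toReal / M Y)) :=
    exp_neg_le_integral_mul_exp_neg_div hM0 hk0 hMi hM1 hki hk_int
  have hInt : Integrable fun Y => M Y * Real.exp (-((κ Y).toReal / M Y)) :=
    integrable_mul_exp_neg_div hM0 hk0 hMi hki
  calc ENNReal.ofReal (Real.exp (-max C 0) * ((n + 1 : ℕ) : ℝ))
      = (n + 1 : ℝ≥0∞) * ENNReal.ofReal (Real.exp (-max C 0)) := by
        rw [ENNReal.ofReal_mul (Real.exp_pos _).le, ENNReal.ofReal_natCast, Nat.cast_succ, mul_comm]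
    _ ≤ (n + 1 : ℝ≥0∞) * ENNReal.ofReal (∫ Y, M Y * Real.exp (-((κ Y).toReal / M Y))) := by
        gcongr
    _ = (n + 1 : ℝ≥0∞) * ∫⁻ Y, ENNReal.ofReal (M Y * Real.exp (-((κ Y).toReal / M Y))) := by
        rw [ofReal_integral_eq_lintegral_ofReal hInt
          (ae_of_all _ fun Y => mul_nonneg (hM0 Y) (Real.exp_pos _).le)]
    _ ≤ (n + 1 : ℝ≥0∞) * ∫⁻ Y, ENNReal.ofReal (S Y ^ 2 / V) := by
        gcongr 1
        exact lintegral_mono_ae hae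

end EntropicZeroMode

open EntropicZeroMode in
/-- **`EntropicZeroMode` (stmt-AtomisticToContinuum-13444), as stated in the route file.**
`CondEntropyBound →` for every repulsive finite-range `v` there is `ρ₀ > 0` such that for
`0 < ρ < ρ₀` there is `c > 0` with: for all large `N` there is `δ > 0` such that every nonnegative
`δ`-near-minimiser `Ψ` has `⟨φ₀, γ_Ψ φ₀⟩ ≥ c N` (`φ₀ = L^{-3/2} 1_Λ`, `L = (N/ρ)^{1/3}`). Take `ρ₀` and
`C` from `CondEntropyBound`, `c = e^{-max C 0}`, and shift the filter `N = n + 1`; the estimate is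
`occupation_flatMode_ge` (Rényi-½ identity + Jensen, Reatto 1969 / Penrose–Onsager 1956 for the
objects; the argument is elementary). [folklore] -/
theorem entropicZeroMode_proof :
    Summit.AtomisticToContinuum.BoseEinsteinCondensation.Theses.BECCellInformation.EntropicZeroMode := by
  unfold Summit.AtomisticToContinuum.BoseEinsteinCondensation.Theses.BECCellInformation.EntropicZeroMode
    Summit.AtomisticToContinuum.BoseEinsteinCondensation.Theses.BECCellInformation.CondEntropyBound
  intro hX v hv
  obtain ⟨ρ₀, hρ₀, H⟩ := hX v hv
  refine ⟨ρ₀, hρ₀, fun ρ hρ hρlt => ?_⟩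
  obtain ⟨C, hev⟩ := H ρ hρ hρlt
  refine ⟨Real.exp (-max C 0), Real.exp_pos _, ?_⟩
  obtain ⟨n₀, hn₀⟩ := Filter.eventually_atTop.mp hev
  refine Filter.eventually_atTop.mpr ⟨n₀ + 1, fun N hN => ?_⟩
  obtain ⟨n, rfl⟩ : ∃ n, N = n + 1 := ⟨N - 1, by omega⟩
  obtain ⟨δ, hδ, hδΨ⟩ := hn₀ n (by omega)
  refine ⟨δ, hδ, fun Ψ hE hnn => ?_⟩
  have hLpos : 0 < sideLength ρ (n + 1) := by
    unfold sideLength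
    exact Real.rpow_pos_of_pos (div_pos (Nat.cast_pos.mpr (Nat.succ_pos n)) hρ) _
  exact occupation_flatMode_ge hLpos Ψ hnn (hδΨ Ψ hE hnn)

end Summit.AtomisticToContinuum.BoseEinsteinCondensation.Theorems

end
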